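import Summits.AtomisticToContinuum.HydrodynamicLimit.Theorems.CollisionIsometryCLTAdaptedWeightCLTCBFreeStretch
import Summits.AtomisticToContinuum.HydrodynamicLimit.Theorems.CollisionIsometryCLTAdaptedWeightCLTTLPastDampingWindows
import Summits.AtomisticToContinuum.HydrodynamicLimit.Theorems.LambertianContactSwapLambertianEulerTailsZero

/-!
# Stub `stub_timeZero` of the line `Sketch` (contact-balance composition) for the crux
`AdaptedWeightCLT` (stmt-AtomisticToContinuum-14868; `--supports`)

TIME-ZERO STATICS of the local Gibbs law: the block anisotropy `anis = ∫ₓ Σ D² + |q|²` of the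
INITIAL configuration is `O_P(1)`, so `P_N{(N+1)^p < anis(Φ_0 z)} → 0` for every `p > 0`.

* DETERMINISTIC BOUND on the hard-sphere domain, for `N ≥ N₀(γ)`:
  `anis(z) ≤ K_a · (27 C/σ³ + 1) · (N+1)⁻¹ Σ_i e^{a‖v_i‖²}` for every `a > 0`, with
  `K_a = 1152 (a⁻² + a⁻³)`. Pointwise in `x`, with block weights `w_i ≥ 0`, `W = Σ w_i` and the
  block velocity `ū` (the `w`-average of the `v_i`): `|⟨C2, y⊗y⟩| ≤ 2‖y‖²`, `|⟨C3, y^{⊗3}⟩| ≤ ‖y‖³`,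
  `‖v_i − ū‖^r ≤ 2^{r−1}(‖v_i‖^r + ‖ū‖^r)`, JENSEN `W‖ū‖^r ≤ Σ w_i‖v_i‖^r`, CAUCHY–SCHWARZ
  `(Σ w_i‖v_i‖^r)² ≤ W Σ w_i‖v_i‖^{2r}` and `‖v‖^{2r} ≤ r!/a^r · e^{a‖v‖²}`; hence
  `Σ D² + |q|² ≤ K_a · ((N+1)⁻¹ W) · (N+1)⁻¹ Σ_i w_i e^{a‖v_i‖²}`; the HARD-CORE DENSITY CAP
  `(N+1)⁻¹ W ≤ 27 C/σ³` (`PastDamping.sum_kernel_le`, as in `stub_lipschitz`) and `∫ₓ w_i = 1`.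
* PROBABILITY: Gaussian velocity moments of the local Gibbs law uniformly in `N` (`LambertianContactSwap…
  TailsZero.localGibbs_expVelocityMoment_le`), Markov; `Φ_0 = id` on the good set (conull, in the domain).
-/

namespace Summit.AtomisticToContinuum.HydrodynamicLimit.Theorems.ContactBalance

open scoped BigOperators Topology Classical MeasureTheory ENNReal InnerProductSpace
open Filter Set MeasureTheory
open Literature.Analysis.FluidPDE
open Summit.AtomisticToContinuum.HydrodynamicLimit.Theorems.ContactSourceDuhamel
open Summit.AtomisticToContinuum.HydrodynamicLimit.Theorems.ContactSourceDuhamel.TimeLocal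
open Literature.MathematicalPhysics.KineticTheory (hsDiameter hsDiameter_pos hsDiameter_le localGibbsLaw
  localGibbsLaw_absolutelyContinuous)

noncomputable section

namespace TimeZero

/-! ## Velocity algebra over one block -/

/-- JENSEN for the weighted average of velocities: `(Σ a) ‖ū‖^p ≤ Σ a_i ‖v_i‖^p`,
`ū = (Σ a)⁻¹ Σ a_i v_i` (also in the junk case `Σ a = 0`). -/
theorem sum_mul_norm_avg_pow_le {ι : Type*} (s : Finset ι) {a : ι → ℝ} (v : ι → V3)
    (ha : ∀ i ∈ s, 0 ≤ a i) (p : ℕ) :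
    (∑ i ∈ s, a i) * ‖(∑ i ∈ s, a i)⁻¹ • ∑ i ∈ s, a i • v i‖ ^ p ≤ ∑ i ∈ s, a i * ‖v i‖ ^ p := by
  have hS0 : 0 ≤ ∑ i ∈ s, a i * ‖v i‖ ^ p :=
    Finset.sum_nonneg fun i hi => mul_nonneg (ha i hi) (pow_nonneg (norm_nonneg _) _)
  rcases (Finset.sum_nonneg ha).eq_or_lt with h0 | hpos
  · rw [← h0, zero_mul]; exact hS0
  · set W := ∑ i ∈ s, a i with hW
    have hW0 : W ≠ 0 := hpos.ne'
    have hnorm : ‖W⁻¹ • ∑ i ∈ s, a i • v i‖ ≤ ∑ i ∈ s, a i / W * ‖v i‖ := by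
      rw [norm_smul, norm_inv, Real.norm_eq_abs, abs_of_pos hpos]
      calc W⁻¹ * ‖∑ i ∈ s, a i • v i‖ ≤ W⁻¹ * ∑ i ∈ s, a i * ‖v i‖ := by
            refine mul_le_mul_of_nonneg_left ((norm_sum_le _ _).trans (le_of_eq ?_))
              (inv_nonneg.2 hpos.le)
            exact Finset.sum_congr rfl fun i hi => by
              rw [norm_smul, Real.norm_eq_abs, abs_of_nonneg (ha i hi)]
        _ = ∑ i ∈ s, a i / W * ‖v i‖ := by
            rw [Finset.mul_sum]
            exact Finset.sum_congr rfl fun i _ => by ring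
    have hw1 : ∑ i ∈ s, a i / W = 1 := by rw [← Finset.sum_div, div_self hW0]
    have hJ := Real.pow_arith_mean_le_arith_mean_pow s (fun i => a i / W) (fun i => ‖v i‖)
      (fun i hi => div_nonneg (ha i hi) hpos.le) hw1 (fun i _ => norm_nonneg _) p
    calc W * ‖W⁻¹ • ∑ i ∈ s, a i • v i‖ ^ p ≤ W * (∑ i ∈ s, a i / W * ‖v i‖) ^ p :=
          mul_le_mul_of_nonneg_left (pow_le_pow_left₀ (norm_nonneg _) hnorm p) hpos.le
      _ ≤ W * ∑ i ∈ s, a i / W * ‖v i‖ ^ p := mul_le_mul_of_nonneg_left hJ hpos.le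
      _ = ∑ i ∈ s, a i * ‖v i‖ ^ p := by
          rw [Finset.mul_sum]
          exact Finset.sum_congr rfl fun i _ => by field_simp

/-- Even powers against the Gaussian weight: `(‖v‖^r)² ≤ r!/a^r · e^{a‖v‖²}` (`a > 0`). -/
theorem pow_sq_le_exp {a : ℝ} (ha : 0 < a) (r : ℕ) (v : V3) :
    (‖v‖ ^ r) ^ 2 ≤ (r.factorial / a ^ r) * Real.exp (a * ‖v‖ ^ 2) := by
  have hx : 0 ≤ a * ‖v‖ ^ 2 := by positivity
  have h1 := Real.pow_div_factorial_le_exp (a * ‖v‖ ^ 2) hx r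
  have hfact : (0 : ℝ) < r.factorial := by exact_mod_cast Nat.factorial_pos r
  have har : 0 < a ^ r := pow_pos ha r
  rw [div_le_iff₀ hfact] at h1
  rw [div_mul_eq_mul_div, le_div_iff₀ har]
  calc (‖v‖ ^ r) ^ 2 * a ^ r = (a * ‖v‖ ^ 2) ^ r := by ring
    _ ≤ Real.exp (a * ‖v‖ ^ 2) * r.factorial := h1
    _ = r.factorial * Real.exp (a * ‖v‖ ^ 2) := mul_comm _ _

/-- ONE COMPONENT: if `|⟨C', y^{⊗r}⟩| ≤ c‖y‖^r`, then for weights `a_i ≥ 0` and the weighted average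
`ū` of the `v_i`, `(Σ a_i ⟨C', (v_i − ū)^{⊗r}⟩)² ≤ (c 2^r)² (Σ a) Σ a_i ‖v_i‖^{2r}`
(triangle, Jensen for `‖ū‖^r`, Cauchy–Schwarz). -/
theorem sq_sum_pairT_le {ι : Type*} (s : Finset ι) {r : ℕ} (hr : 1 ≤ r) {C' : Tens r} {c : ℝ}
    (hc0 : 0 ≤ c) (hc : ∀ y, |pairT C' (tpow r y)| ≤ c * ‖y‖ ^ r) {a : ι → ℝ}
    (ha : ∀ i ∈ s, 0 ≤ a i) (v : ι → V3) :
    (∑ i ∈ s, a i * pairT C' (tpow r (v i - (∑ i ∈ s, a i)⁻¹ • ∑ i ∈ s, a i • v i))) ^ 2 ≤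
      (c * 2 ^ r) ^ 2 * (∑ i ∈ s, a i) * ∑ i ∈ s, a i * (‖v i‖ ^ r) ^ 2 := by
  set u := (∑ i ∈ s, a i)⁻¹ • ∑ i ∈ s, a i • v i with hu
  set W := ∑ i ∈ s, a i with hW
  set S := ∑ i ∈ s, a i * ‖v i‖ ^ r with hS
  have hS0 : 0 ≤ S := Finset.sum_nonneg fun i hi => mul_nonneg (ha i hi) (pow_nonneg (norm_nonneg _) _)
  have hJ : W * ‖u‖ ^ r ≤ S := sum_mul_norm_avg_pow_le s v ha r
  have hc2 : 0 ≤ c * 2 ^ (r - 1) := mul_nonneg hc0 (pow_nonneg (by norm_num) _)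
  -- triangle inequality and Jensen
  have h1 : |∑ i ∈ s, a i * pairT C' (tpow r (v i - u))| ≤ c * 2 ^ r * S := by
    calc |∑ i ∈ s, a i * pairT C' (tpow r (v i - u))|
        ≤ ∑ i ∈ s, |a i * pairT C' (tpow r (v i - u))| := Finset.abs_sum_le_sum_abs _ _
      _ ≤ ∑ i ∈ s, a i * (c * 2 ^ (r - 1) * (‖v i‖ ^ r + ‖u‖ ^ r)) := by
          refine Finset.sum_le_sum fun i hi => ?_
          rw [abs_mul, abs_of_nonneg (ha i hi)]
          refine mul_le_mul_of_nonneg_left ((hc _).trans ?_) (ha i hi)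
          rw [mul_assoc]
          refine mul_le_mul_of_nonneg_left ?_ hc0
          exact (pow_le_pow_left₀ (norm_nonneg _) (norm_sub_le _ _) r).trans
            (add_pow_le (norm_nonneg _) (norm_nonneg _) r)
      _ = c * 2 ^ (r - 1) * (S + W * ‖u‖ ^ r) := by
          rw [hS, hW, Finset.sum_mul, ← Finset.sum_add_distrib, Finset.mul_sum]
          exact Finset.sum_congr rfl fun i _ => by ring
      _ ≤ c * 2 ^ (r - 1) * (S + S) := mul_le_mul_of_nonneg_left (by linarith) hc2
      _ = c * 2 ^ r * S := by
          have h2 : (2 : ℝ) ^ r = 2 ^ (r - 1) * 2 := by rw [← pow_succ, Nat.sub_add_cancel hr]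
          rw [h2]; ring
  -- Cauchy–Schwarz
  have h2 : S ^ 2 ≤ W * ∑ i ∈ s, a i * (‖v i‖ ^ r) ^ 2 :=
    Finset.sum_sq_le_sum_mul_sum_of_sq_le_mul s ha (fun i hi => mul_nonneg (ha i hi) (sq_nonneg _))
      fun i _ => le_of_eq (by ring)
  calc (∑ i ∈ s, a i * pairT C' (tpow r (v i - u))) ^ 2 ≤ (c * 2 ^ r * S) ^ 2 :=
        sq_le_sq' (abs_le.1 h1).1 (abs_le.1 h1).2
    _ = (c * 2 ^ r) ^ 2 * S ^ 2 := by ring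
    _ ≤ (c * 2 ^ r) ^ 2 * (W * ∑ i ∈ s, a i * (‖v i‖ ^ r) ^ 2) :=
        mul_le_mul_of_nonneg_left h2 (sq_nonneg _)
    _ = _ := by ring

/-! ## The pointwise bound on the defect -/

variable {γ C : ℝ} {φ : ℕ → T3 → ℝ} {N : ℕ}

/-- POINTWISE: `Σ D² + |q|² ≤ K_a · ((N+1)⁻¹ Σ_i w_i) · (N+1)⁻¹ Σ_i w_i e^{a‖v_i‖²}`,
`K_a = 1152 (a⁻² + a⁻³)`. -/
theorem defectC_le (hadm : AdmissibleKernel γ C φ) {a : ℝ} (ha : 0 < a) (z : Cfg N) (x : T3) :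
    defectC N φ z x ≤ (1152 * ((a ^ 2)⁻¹ + (a ^ 3)⁻¹)) * ((((N + 1 : ℕ) : ℝ)⁻¹ * ∑ i, wgtC N φ z x i) *
      (((N + 1 : ℕ) : ℝ)⁻¹ * ∑ i, wgtC N φ z x i * Real.exp (a * ‖(z i).2‖ ^ 2))) := by
  have h0 : ∀ i ∈ (Finset.univ : Finset (Fin (N + 1))), 0 ≤ wgtC N φ z x i := fun i _ => hadm.2.1 N _
  set W : ℝ := ∑ i, wgtC N φ z x i with hWdef
  set E : ℝ := ∑ i, wgtC N φ z x i * Real.exp (a * ‖(z i).2‖ ^ 2) with hEdef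
  set M : ℝ := ((N + 1 : ℕ) : ℝ) with hMdef
  have hW0 : 0 ≤ W := Finset.sum_nonneg h0
  have hMi : 0 ≤ M⁻¹ := inv_nonneg.2 (Nat.cast_nonneg _)
  -- even powers against the Gaussian weight
  have hE : ∀ r : ℕ, ∑ i, wgtC N φ z x i * (‖(z i).2‖ ^ r) ^ 2 ≤ (r.factorial / a ^ r) * E := by
    intro r
    rw [hEdef, Finset.mul_sum]
    refine Finset.sum_le_sum fun i hi => ?_
    calc wgtC N φ z x i * (‖(z i).2‖ ^ r) ^ 2
        ≤ wgtC N φ z x i * ((r.factorial / a ^ r) * Real.exp (a * ‖(z i).2‖ ^ 2)) :=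
          mul_le_mul_of_nonneg_left (pow_sq_le_exp ha r _) (h0 i hi)
      _ = (r.factorial / a ^ r) * (wgtC N φ z x i * Real.exp (a * ‖(z i).2‖ ^ 2)) := by ring
  have hf2 : ((2 : ℕ).factorial : ℝ) = 2 := by simp [Nat.factorial]
  have hf3 : ((3 : ℕ).factorial : ℝ) = 6 := by simp [Nat.factorial]
  -- the two channels
  have h2 : ∀ j k : Fin 3, blkC 2 N φ z x (C2 j k) ^ 2 ≤ M⁻¹ ^ 2 * (64 * W * (2 / a ^ 2 * E)) := by
    intro j k
    unfold blkC
    rw [mul_pow, Pointwise.ubarC_eq]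
    refine mul_le_mul_of_nonneg_left ?_ (sq_nonneg _)
    refine (sq_sum_pairT_le Finset.univ (by norm_num : 1 ≤ 2) (by norm_num : (0 : ℝ) ≤ 2)
      (Pointwise.abs_pairT_C2_le j k) h0 fun i => (z i).2).trans ?_
    have h := hE 2
    rw [hf2] at h
    calc (2 * 2 ^ 2) ^ 2 * W * ∑ i, wgtC N φ z x i * (‖(z i).2‖ ^ 2) ^ 2
        ≤ (2 * 2 ^ 2) ^ 2 * W * (2 / a ^ 2 * E) := mul_le_mul_of_nonneg_left h (mul_nonneg (by positivity) hW0)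
      _ = 64 * W * (2 / a ^ 2 * E) := by norm_num
  have h3 : ∀ b : Fin 3, blkC 3 N φ z x (C3 b) ^ 2 ≤ M⁻¹ ^ 2 * (64 * W * (6 / a ^ 3 * E)) := by
    intro b
    unfold blkC
    rw [mul_pow, Pointwise.ubarC_eq]
    refine mul_le_mul_of_nonneg_left ?_ (sq_nonneg _)
    have hc : ∀ y : V3, |pairT (C3 b) (tpow 3 y)| ≤ 1 * ‖y‖ ^ 3 := fun y => by
      rw [one_mul]; exact Pointwise.abs_pairT_C3_le b y
    refine (sq_sum_pairT_le Finset.univ (by norm_num : 1 ≤ 3) zero_le_one hc h0 fun i => (z i).2).trans ?_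
    have h := hE 3
    rw [hf3] at h
    calc (1 * 2 ^ 3) ^ 2 * W * ∑ i, wgtC N φ z x i * (‖(z i).2‖ ^ 3) ^ 2
        ≤ (1 * 2 ^ 3) ^ 2 * W * (6 / a ^ 3 * E) := mul_le_mul_of_nonneg_left h (mul_nonneg (by positivity) hW0)
      _ = 64 * W * (6 / a ^ 3 * E) := by norm_num
  -- sum over the twelve components
  have hS2 : ∑ j : Fin 3, ∑ k : Fin 3, blkC 2 N φ z x (C2 j k) ^ 2 ≤
      ∑ _j : Fin 3, ∑ _k : Fin 3, M⁻¹ ^ 2 * (64 * W * (2 / a ^ 2 * E)) :=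
    Finset.sum_le_sum fun j _ => Finset.sum_le_sum fun k _ => h2 j k
  have hS3 : ∑ b : Fin 3, blkC 3 N φ z x (C3 b) ^ 2 ≤ ∑ _b : Fin 3, M⁻¹ ^ 2 * (64 * W * (6 / a ^ 3 * E)) :=
    Finset.sum_le_sum fun b _ => h3 b
  simp only [Finset.sum_const, Finset.card_univ, Fintype.card_fin, nsmul_eq_mul, Nat.cast_ofNat] at hS2 hS3
  unfold defectC
  calc _ ≤ 3 * (3 * (M⁻¹ ^ 2 * (64 * W * (2 / a ^ 2 * E)))) + 3 * (M⁻¹ ^ 2 * (64 * W * (6 / a ^ 3 * E))) :=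
        add_le_add hS2 hS3
    _ = (1152 * ((a ^ 2)⁻¹ + (a ^ 3)⁻¹)) * ((M⁻¹ * W) * (M⁻¹ * E)) := by
        rw [div_eq_mul_inv, div_eq_mul_inv]
        ring

/-! ## The hard-core density cap and the integrated bound -/

/-- DENSITY CAP: for `N ≥ N₀(γ)`, on the hard-sphere domain of diameter `ε_N = σ (N+1)^{-1/3}`,
`(N+1)⁻¹ Σ_i w_i(x) ≤ 27 C/σ³` at every `x` (`PastDamping.sum_kernel_le`;
`(2R/ε_N + 1)³ ≤ 27 R³ (N+1)/σ³` for `R = (N+1)^{−γ} ≥ ε_N`). -/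
theorem density_cap (hadm : AdmissibleKernel γ C φ) (hγ : 0 < γ) (hγ' : γ ≤ 1 / 15) {σ : ℝ}
    (hσ : 0 < σ) (hσ' : σ < 2⁻¹) :
    ∃ N₀ : ℕ, ∀ N : ℕ, N₀ ≤ N →
      ∀ z ∈ hardSphereDomain (Torus.geometry (Fin 3)) (N + 1) (hsDiameter σ N), ∀ x : T3,
        ((N + 1 : ℕ) : ℝ)⁻¹ * ∑ i, wgtC N φ z x i ≤ 27 * C / σ ^ 3 := by
  -- `N₀`: `(N+1)^{-γ} < 1/4` beyond it (as in `stub_lipschitz`)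
  obtain ⟨N₀, hN₀⟩ := Filter.eventually_atTop.1
    ((tendsto_order.1 ((tendsto_rpow_neg_atTop hγ).comp tendsto_natCast_atTop_atTop)).2 (1 / 4)
      (by norm_num))
  refine ⟨N₀, fun N hN z hz x => ?_⟩
  have hC0 : 0 ≤ C := Pointwise.admissible_C_nonneg hadm
  have hR4 : ((N + 1 : ℕ) : ℝ) ^ (-γ) < 1 / 4 := hN₀ (N + 1) (by omega)
  have hMc : ((N : ℝ) + 1) = ((N + 1 : ℕ) : ℝ) := (Nat.cast_succ N).symm
  have hsupp : ∀ y, ((N + 1 : ℕ) : ℝ) ^ (-γ) ≤ Torus.euclidDist y 0 → φ N y = 0 :=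
    fun y hy => hadm.2.2.2.1 N y (by rwa [hMc])
  have hCmax : ∀ y, φ N y ≤ C * ((N + 1 : ℕ) : ℝ) ^ (3 * γ) := fun y => by
    rw [← hMc]; exact hadm.2.2.2.2.1 N y
  set M : ℝ := ((N + 1 : ℕ) : ℝ) with hMdef
  have hM0 : 0 < M := by rw [hMdef]; positivity
  have hM1 : 1 ≤ M := by rw [hMdef]; exact_mod_cast Nat.succ_pos N
  set R : ℝ := M ^ (-γ) with hRdef
  have hR0 : 0 < R := Real.rpow_pos_of_pos hM0 _
  set ε : ℝ := hsDiameter σ N with hεdef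
  have hε0 : 0 < ε := hsDiameter_pos hσ N
  have hεσ : ε ≤ σ := hsDiameter_le hσ.le N
  have hεM : ε = σ * M ^ (-(1 / 3 : ℝ)) := rfl
  have hε3 : ε ^ 3 = σ ^ 3 * M⁻¹ := by
    rw [hεM, mul_pow, ← Real.rpow_natCast (M ^ (-(1 / 3 : ℝ))), ← Real.rpow_mul hM0.le,
      ← Real.rpow_neg_one]
    norm_num
  have hεR : ε ≤ R := by
    rw [hεM]
    calc σ * M ^ (-(1 / 3 : ℝ)) ≤ 1 * M ^ (-(1 / 3 : ℝ)) :=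
          mul_le_mul_of_nonneg_right (by linarith) (Real.rpow_nonneg hM0.le _)
      _ ≤ R := by rw [one_mul]; exact Real.rpow_le_rpow_of_exponent_le hM1 (by linarith)
  have hhalf : R + ε / 2 < 1 / 2 := by linarith
  -- the cap
  have hsum : ∑ i, wgtC N φ z x i ≤ C * M ^ (3 * γ) * (2 * R / ε + 1) ^ 3 :=
    PastDamping.sum_kernel_le hz (φ N) (hadm.2.1 N) hCmax hsupp hε0 hR0.le hhalf x
  -- bookkeeping
  have hP : (2 * R / ε + 1) ^ 3 ≤ 27 * R ^ 3 * M / σ ^ 3 := by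
    have h1 : 1 ≤ R / ε := (one_le_div hε0).2 hεR
    have h2 : 2 * R / ε + 1 ≤ 3 * (R / ε) := by rw [mul_div_assoc]; linarith
    calc (2 * R / ε + 1) ^ 3 ≤ (3 * (R / ε)) ^ 3 := pow_le_pow_left₀ (by positivity) h2 3
      _ = 27 * R ^ 3 / ε ^ 3 := by rw [mul_pow, div_pow]; ring
      _ = 27 * R ^ 3 * M / σ ^ 3 := by rw [hε3]; field_simp
  have hR3 : M ^ (3 * γ) * R ^ 3 = 1 := by
    rw [hRdef, ← Real.rpow_natCast (M ^ (-γ)), ← Real.rpow_mul hM0.le, ← Real.rpow_add hM0]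
    have : 3 * γ + -γ * ((3 : ℕ) : ℝ) = 0 := by push_cast; ring
    rw [this, Real.rpow_zero]
  have hCM : 0 ≤ C * M ^ (3 * γ) := mul_nonneg hC0 (Real.rpow_nonneg hM0.le _)
  calc M⁻¹ * ∑ i, wgtC N φ z x i ≤ M⁻¹ * (C * M ^ (3 * γ) * (2 * R / ε + 1) ^ 3) :=
        mul_le_mul_of_nonneg_left hsum (inv_nonneg.2 hM0.le)
    _ ≤ M⁻¹ * (C * M ^ (3 * γ) * (27 * R ^ 3 * M / σ ^ 3)) :=
        mul_le_mul_of_nonneg_left (mul_le_mul_of_nonneg_left hP hCM) (inv_nonneg.2 hM0.le)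
    _ = 27 * C / σ ^ 3 * (M ^ (3 * γ) * R ^ 3) * (M⁻¹ * M) := by ring
    _ = 27 * C / σ ^ 3 := by rw [hR3, inv_mul_cancel₀ hM0.ne', mul_one, mul_one]

/-- THE DETERMINISTIC BOUND: for `N ≥ N₀(γ)` and `z` in the hard-sphere domain,
`anis(z) ≤ K_a (27 C/σ³ + 1) · (N+1)⁻¹ Σ_i e^{a‖v_i‖²}` (integrate the pointwise bound with the
density cap inserted; `∫ₓ w_i(x) dx = ∫ φ_N = 1`). -/
theorem anisC_le (hadm : AdmissibleKernel γ C φ) (hγ : 0 < γ) (hγ' : γ ≤ 1 / 15) {σ : ℝ}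
    (hσ : 0 < σ) (hσ' : σ < 2⁻¹) {a : ℝ} (ha : 0 < a) :
    ∃ N₀ : ℕ, ∀ N : ℕ, N₀ ≤ N →
      ∀ z ∈ hardSphereDomain (Torus.geometry (Fin 3)) (N + 1) (hsDiameter σ N),
        anisC N φ z ≤ (1152 * ((a ^ 2)⁻¹ + (a ^ 3)⁻¹)) * (27 * C / σ ^ 3 + 1) * PastDamping.expMoment a N z := by
  obtain ⟨N₀, hN₀⟩ := density_cap hadm hγ hγ' hσ hσ'
  refine ⟨N₀, fun N hN z hz => ?_⟩
  have hK : (0 : ℝ) ≤ (1152 * ((a ^ 2)⁻¹ + (a ^ 3)⁻¹)) := by positivity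
  have h0 : ∀ (x : T3) (i : Fin (N + 1)), 0 ≤ wgtC N φ z x i := fun x i => hadm.2.1 N _
  have hMi : (0 : ℝ) ≤ ((N + 1 : ℕ) : ℝ)⁻¹ := inv_nonneg.2 (Nat.cast_nonneg _)
  have hwI : ∀ i, Integrable fun x => wgtC N φ z x i := fun i =>
    PastDamping.integrable_of_continuous_T3 (FreeStretch.continuous_wgtC (hadm.1 N).continuous z i)
  have hwi : ∀ i, ∫ x, wgtC N φ z x i = 1 := fun i => by
    show ∫ x, φ N ((z i).1 - x) = 1
    rw [PastDamping.integral_comp_sub_left (φ N) (z i).1]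
    exact hadm.2.2.1 N
  -- pointwise domination by an integrable majorant (density cap inserted)
  have hdom : ∀ x, defectC N φ z x ≤ (1152 * ((a ^ 2)⁻¹ + (a ^ 3)⁻¹)) * (27 * C / σ ^ 3 + 1) *
      (((N + 1 : ℕ) : ℝ)⁻¹ * ∑ i, wgtC N φ z x i * Real.exp (a * ‖(z i).2‖ ^ 2)) := by
    intro x
    have hEx : 0 ≤ ((N + 1 : ℕ) : ℝ)⁻¹ * ∑ i, wgtC N φ z x i * Real.exp (a * ‖(z i).2‖ ^ 2) :=
      mul_nonneg hMi (Finset.sum_nonneg fun i _ => mul_nonneg (h0 x i) (Real.exp_pos _).le)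
    have hcap : ((N + 1 : ℕ) : ℝ)⁻¹ * ∑ i, wgtC N φ z x i ≤ 27 * C / σ ^ 3 + 1 := by
      linarith [hN₀ N hN z hz x]
    calc defectC N φ z x ≤ _ := defectC_le hadm ha z x
      _ ≤ (1152 * ((a ^ 2)⁻¹ + (a ^ 3)⁻¹)) * ((27 * C / σ ^ 3 + 1) *
          (((N + 1 : ℕ) : ℝ)⁻¹ * ∑ i, wgtC N φ z x i * Real.exp (a * ‖(z i).2‖ ^ 2))) :=
          mul_le_mul_of_nonneg_left (mul_le_mul_of_nonneg_right hcap hEx) hK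
      _ = _ := by ring
  have hgI : Integrable fun x => (1152 * ((a ^ 2)⁻¹ + (a ^ 3)⁻¹)) * (27 * C / σ ^ 3 + 1) *
      (((N + 1 : ℕ) : ℝ)⁻¹ * ∑ i, wgtC N φ z x i * Real.exp (a * ‖(z i).2‖ ^ 2)) :=
    ((integrable_finsetSum Finset.univ fun i _ =>
      (hwI i).mul_const (Real.exp (a * ‖(z i).2‖ ^ 2))).const_mul _).const_mul _
  calc anisC N φ z = ∫ x, defectC N φ z x := rfl
    _ ≤ ∫ x, (1152 * ((a ^ 2)⁻¹ + (a ^ 3)⁻¹)) * (27 * C / σ ^ 3 + 1) *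
        (((N + 1 : ℕ) : ℝ)⁻¹ * ∑ i, wgtC N φ z x i * Real.exp (a * ‖(z i).2‖ ^ 2)) :=
        integral_mono_of_nonneg (Eventually.of_forall fun x => FreeStretch.defectC_nonneg φ z x) hgI
          (Eventually.of_forall hdom)
    _ = (1152 * ((a ^ 2)⁻¹ + (a ^ 3)⁻¹)) * (27 * C / σ ^ 3 + 1) * PastDamping.expMoment a N z := by
        rw [integral_const_mul, integral_const_mul,
          integral_finsetSum Finset.univ fun i _ => (hwI i).mul_const (Real.exp (a * ‖(z i).2‖ ^ 2))]
        simp only [integral_mul_const, hwi, one_mul]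
        rfl

end TimeZero

open TimeZero in
/-- STUB 5 (time zero; statics of the local Gibbs law). For every `p > 0`,
`P_N{(N+1)^p < anis(Φ_0 z)} → 0`: on the hard-sphere domain `anis(z) ≤ A · (N+1)⁻¹ Σ_i e^{a‖v_i‖²}`
for `N` large (`TimeZero.anisC_le`: weighted Cauchy–Schwarz/Jensen over each block, the hard-core
density cap, `∫ₓ w_i dx = 1`), the Gaussian velocity moments of the local Gibbs law are bounded
uniformly in `N` (`LambertianContactSwapLambertianEulerTailsZero.localGibbs_expVelocityMoment_le`),
Markov; `Φ_0 = id` on the good set, whose complement is null for the local Gibbs law. -/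
theorem stub_timeZero : ∀ (a₀ θ₀ : T3 → ℝ) (u₀ : T3 → V3), NiceProfiles a₀ θ₀ u₀ →
    ∀ σ : ℝ, 0 < σ → σ < 2⁻¹ → ∀ (γ C : ℝ) (φ : ℕ → T3 → ℝ), 0 < γ → γ ≤ 1 / 15 → AdmissibleKernel γ C φ →
      ∀ (Φ : Flows σ) (p : ℝ), 0 < p →
        Tendsto (fun N : ℕ => localGibbsLaw σ a₀ u₀ θ₀ N (Φ N)
          {z | ((N + 1 : ℕ) : ℝ) ^ p < anisC N φ ((Φ N).flow 0 z)}) atTop (𝓝 0) := by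
  intro a₀ θ₀ u₀ hnice σ hσ hσ' γ C φ hγ hγ' hadm Φ p hp
  obtain ⟨hca, hcθ, hcu, ha0, hθ0⟩ := hnice
  have hσ2 : σ ≤ 1 / 2 := by rw [one_div]; exact hσ'.le
  obtain ⟨a, ha, Cexp, hCexp, hmom⟩ :=
    LambertianContactSwapLambertianEulerTailsZero.localGibbs_expVelocityMoment_le hca hcθ hcu ha0 hθ0 hσ2
  obtain ⟨N₀, hN₀⟩ := anisC_le hadm hγ hγ' hσ hσ' ha
  have hC0 : 0 ≤ C := Pointwise.admissible_C_nonneg hadm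
  set A : ℝ := (1152 * ((a ^ 2)⁻¹ + (a ^ 3)⁻¹)) * (27 * C / σ ^ 3 + 1) with hAdef
  have hA : 0 < A := by positivity
  have hMpos : ∀ N : ℕ, (0 : ℝ) < ((N + 1 : ℕ) : ℝ) := fun N => by positivity
  have ht : ∀ N : ℕ, 0 < ((N + 1 : ℕ) : ℝ) ^ p / A := fun N =>
    div_pos (Real.rpow_pos_of_pos (hMpos N) p) hA
  -- the event is contained in a null set and a Markov event (`N ≥ N₀`)
  have hincl : ∀ N : ℕ, N₀ ≤ N →
      {z : Cfg N | ((N + 1 : ℕ) : ℝ) ^ p < anisC N φ ((Φ N).flow 0 z)} ⊆ (Φ N).goodᶜ ∪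
        {z | ENNReal.ofReal (((N + 1 : ℕ) : ℝ) ^ p / A) ≤ ENNReal.ofReal (PastDamping.expMoment a N z)} := by
    intro N hN z hz
    by_cases hg : z ∈ (Φ N).good
    · simp only [mem_setOf_eq] at hz
      rw [(Φ N).flow_zero z hg] at hz
      have hb := hN₀ N hN z ((Φ N).good_subset hg)
      exact Or.inr (ENNReal.ofReal_le_ofReal ((div_le_iff₀ hA).2 (by linarith [hz.trans_le hb])))
    · exact Or.inl hg
  -- Markov
  have hmarkov : ∀ N : ℕ, localGibbsLaw σ a₀ u₀ θ₀ N (Φ N)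
      {z | ENNReal.ofReal (((N + 1 : ℕ) : ℝ) ^ p / A) ≤ ENNReal.ofReal (PastDamping.expMoment a N z)} ≤
        Cexp / ENNReal.ofReal (((N + 1 : ℕ) : ℝ) ^ p / A) := by
    intro N
    have hmeas : Measurable fun z : Cfg N => ENNReal.ofReal (PastDamping.expMoment a N z) :=
      (PastDamping.measurable_expMoment a N).ennreal_ofReal
    refine (meas_ge_le_lintegral_div hmeas.aemeasurable (ENNReal.ofReal_pos.2 (ht N)).ne'
      ENNReal.ofReal_ne_top).trans (ENNReal.div_le_div_right ?_ _)
    calc ∫⁻ z, ENNReal.ofReal (PastDamping.expMoment a N z) ∂(localGibbsLaw σ a₀ u₀ θ₀ N (Φ N))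
        = ∫⁻ z, Literature.Barriers.AtomisticToContinuum.expVelocityMoment a z
            ∂(localGibbsLaw σ a₀ u₀ θ₀ N (Φ N)) :=
          lintegral_congr fun z => (Literature.Barriers.AtomisticToContinuum.expVelocityMoment_eq a z).symm
      _ ≤ Cexp := hmom N (Φ N)
  -- the Markov bound tends to zero
  have hlim : Tendsto (fun N : ℕ => Cexp / ENNReal.ofReal (((N + 1 : ℕ) : ℝ) ^ p / A)) atTop (𝓝 0) := by
    have hcast : Tendsto (fun N : ℕ => ((N + 1 : ℕ) : ℝ)) atTop atTop :=
      tendsto_natCast_atTop_atTop.comp (tendsto_add_atTop_nat 1)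
    have h1 : Tendsto (fun N : ℕ => A * ((N + 1 : ℕ) : ℝ) ^ (-p)) atTop (𝓝 (A * 0)) :=
      ((tendsto_rpow_neg_atTop hp).comp hcast).const_mul A
    rw [mul_zero] at h1
    have h2 : Tendsto (fun N : ℕ => ENNReal.ofReal (A * ((N + 1 : ℕ) : ℝ) ^ (-p))) atTop (𝓝 0) := by
      rw [← ENNReal.ofReal_zero]; exact ENNReal.tendsto_ofReal h1
    have h3 := ENNReal.Tendsto.const_mul h2 (Or.inr hCexp.ne)
    rw [mul_zero] at h3
    refine Tendsto.congr (fun N => ?_) h3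
    rw [div_eq_mul_inv, ← ENNReal.ofReal_inv_of_pos (ht N), inv_div, Real.rpow_neg (hMpos N).le,
      ← div_eq_mul_inv]
  -- conclude
  refine tendsto_of_tendsto_of_tendsto_of_le_of_le' tendsto_const_nhds hlim
    (Eventually.of_forall fun N => bot_le) ?_
  filter_upwards [eventually_ge_atTop N₀] with N hN
  calc localGibbsLaw σ a₀ u₀ θ₀ N (Φ N) {z | ((N + 1 : ℕ) : ℝ) ^ p < anisC N φ ((Φ N).flow 0 z)}
      ≤ localGibbsLaw σ a₀ u₀ θ₀ N (Φ N) ((Φ N).goodᶜ ∪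
          {z | ENNReal.ofReal (((N + 1 : ℕ) : ℝ) ^ p / A) ≤ ENNReal.ofReal (PastDamping.expMoment a N z)}) :=
        measure_mono (hincl N hN)
    _ ≤ localGibbsLaw σ a₀ u₀ θ₀ N (Φ N) (Φ N).goodᶜ + localGibbsLaw σ a₀ u₀ θ₀ N (Φ N)
          {z | ENNReal.ofReal (((N + 1 : ℕ) : ℝ) ^ p / A) ≤ ENNReal.ofReal (PastDamping.expMoment a N z)} :=
        measure_union_le _ _
    _ ≤ Cexp / ENNReal.ofReal (((N + 1 : ℕ) : ℝ) ^ p / A) := by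
        rw [localGibbsLaw_absolutelyContinuous σ a₀ u₀ θ₀ N (Φ N) (Φ N).measure_compl_good, zero_add]
        exact hmarkov N

end

end Summit.AtomisticToContinuum.HydrodynamicLimit.Theorems.ContactBalance
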